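import Summits.NavierStokesRegularity.FluidComputer.HomSobolevLadder
import Summits.NavierStokesRegularity.FluidComputer.LerayDeadline
import HarnessLib

/-!
# Fluid computer — the SOBOLEV LADDER, scale-invariant form (L51-P / L52-P): the machine is never small in ANY
# scale-invariant pairing `‖u(t)‖₂^{2s−1} × (s-row)`, `1/2 < s ≤ 3/2`

HONEST FRAMING (cell `pub-fluidc`, verbatim): *low prior, high value-of-information experiment on Tao's
machine paradigm; NOT a claim that NS blows up.* Theorem side of the cell; nothing here is evidence of blow-up.

Multiplying a ladder clock (L51 `SobolevLadder.ladder_clock`: `c₁ ν^{(5−2s)/4} (T − t)^{−(2s−1)/4} ≤ L_s(t)`; L52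
`HomSobolevLadder.homSobolev_clock` for `‖u(t)‖_{Ḣ^s}`) by the `(2s−1)/4`-th power of Leray's deadline (L23
`LerayDeadline.deadline`: `4c₂ ν⁵ (T − t) ≤ ‖u(t)‖₂⁴`) cancels `T − t`:

  `c_s · ν^{2s} ≤ ‖u(t)‖₂^{2s−1} · L_s(t)` and `c_s · ν^{2s} ≤ ‖u(t)‖₂^{2s−1} · ‖u(t)‖_{Ḣ^s}` at EVERY `t ∈ (0, T)`,

`c_s = c₁ (4c₂)^{(2s−1)/4}`. Both sides scale the same way under `u ↦ λu(λ²t, λx)` (the pairing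
`‖u‖₂^{2s−1} ‖u‖_{Ḣ^s}` has the dimension of `ν^{2s}`): these are the SCALE-INVARIANT NECESSITIES of the ladder,
one per currency `s`, interpolating the two the dictionary already had — `s = 1`: `2cν⁴ ≤ ‖u‖₂² ∫|∇u|²`
(L23′ `LerayDeadline.energy_enstrophy_product_ge`, squared form) and `s = 3/2`: `c'ν³ ≤ ‖u‖_∞ ‖u‖₂²`
(`LerayTimeFace.amplitude_energy_product_ge`) — down to the critical end `s ↓ 1/2`, where the energy exponent
vanishes and the statement degenerates to Kato's floor `δν < ‖u‖_{L³} ≲ ‖u‖_{Ḣ^{1/2}}` (L28/L28′).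

* `product_of_clock_and_deadline` — the bookkeeping (real exponents);
* `ladder_energy_product` (**L51-P**, `s ∈ (1/2, 3/2]`, `Ḃ^s_{2,1}` row) and `homSobolev_energy_product`
  (**L52-P**, `s ∈ (1/2, 3/2)`, `Ḣ^s`).

Reading for the machine paradigm: a design cannot be 'globally small' in any of these pairings at any instant of a
run that is to blow up — small energy must be paid for by a large `s`-row, with the exchange rate `ν^{2s}` fixed by
scaling; for the cell's fields (`‖u₀‖₂` of order one, `ν = ν₀/ρ`) the floors are tiny (`∝ ν^{2s}`), so as always the
statement is read in FORM. HONEST SIZE NOTE: `c_s` inexplicit and degenerate at the ends of the range; necessity only;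
class = `ℝ³` finite energy. 0 sorry; no new definitions, no named facts.

## References

* J. Leray, Acta Math. 63 (1934), §22 p. 227, §34 (6.4) p. 246. [Leray1934]
* J. C. Robinson, W. Sadowski, Rend. Semin. Mat. Univ. Padova 131 (2014) 159–178, Corollaries 9–10.
  [RobinsonSadowski2014]
-/

noncomputable section

open MeasureTheory Set Function Filter Topology Metric
open scoped ENNReal NNReal
open Literature.Analysis.FluidPDE Literature.Analysis.FunctionSpaces
open Summit.NavierStokesRegularity.FluidComputer.SobolevLadder
open Summit.NavierStokesRegularity.FluidComputer.HomSobolevLadder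

namespace Summit.NavierStokesRegularity.FluidComputer.SobolevLadderProduct

/-- **Bookkeeping: clock × deadline^{(2s−1)/4} is scale-free.** If `4c₂ν⁵(T − t) ≤ E⁴` (deadline, real numbers) and
`ofReal (c₁ ν^{(5−2s)/4} (T − t)^{−(2s−1)/4}) ≤ X` (clock), with `c₁, c₂, ν > 0`, `s > 1/2`, `t < T`, then
`ofReal (c₁ (4c₂)^{(2s−1)/4} ν^{2s}) ≤ ofReal(E)^{2s−1} · X`. [folklore] -/
theorem product_of_clock_and_deadline {c₁ c₂ ν s T t E : ℝ} (hc₁ : 0 < c₁) (hc₂ : 0 < c₂) (hν : 0 < ν)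
    (hs : 1 / 2 < s) (ht : t < T) (hE0 : 0 ≤ E) (hdead : 4 * c₂ * ν ^ 5 * (T - t) ≤ E ^ 4) {X : ℝ≥0∞}
    (hclock : ENNReal.ofReal (c₁ * ν ^ ((5 - 2 * s) / 4) * (T - t) ^ (-((2 * s - 1) / 4))) ≤ X) :
    ENNReal.ofReal (c₁ * (4 * c₂) ^ ((2 * s - 1) / 4) * ν ^ (2 * s)) ≤ ENNReal.ofReal E ^ (2 * s - 1) * X := by
  set b : ℝ := (2 * s - 1) / 4 with hb_def
  set a : ℝ := (5 - 2 * s) / 4 with ha_def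
  have hb : 0 < b := by rw [hb_def]; linarith
  have hTt : 0 < T - t := sub_pos.2 ht
  have hK : 0 < 4 * c₂ * ν ^ 5 := by positivity
  have hE4 : 0 < E ^ 4 := lt_of_lt_of_le (by positivity) hdead
  have hE : 0 < E := by
    rcases hE0.eq_or_lt with h | h
    · rw [← h] at hE4; simp at hE4
    · exact h
  set D : ℝ := E ^ 4 / (4 * c₂ * ν ^ 5) with hD
  have hTD : T - t ≤ D := by
    rw [hD, le_div_iff₀ hK]
    linarith [hdead]
  have hDpos : 0 < D := lt_of_lt_of_le hTt hTD
  -- `(T − t)^{−b} ≥ D^{−b}`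
  have hpow : D ^ (-b) ≤ (T - t) ^ (-b) := by
    rw [Real.rpow_neg hDpos.le, Real.rpow_neg hTt.le]
    exact inv_anti₀ (Real.rpow_pos_of_pos hTt _) (Real.rpow_le_rpow hTt.le hTD hb.le)
  -- the algebra: `E^{4b} · D^{−b} · ν^a = (4c₂)^b ν^{2s}`
  have hP : (E ^ 4) ^ b = E ^ (4 * b) := by
    rw [← Real.rpow_natCast, ← Real.rpow_mul hE.le]
    norm_num
  have hQ : (4 * c₂ * ν ^ 5) ^ b = (4 * c₂) ^ b * ν ^ (5 * b) := by
    rw [Real.mul_rpow (by positivity) (by positivity), ← Real.rpow_natCast ν 5, ← Real.rpow_mul hν.le]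
    norm_num
  have hDb : D ^ (-b) = (4 * c₂) ^ b * ν ^ (5 * b) / E ^ (4 * b) := by
    rw [Real.rpow_neg hDpos.le, hD, Real.div_rpow (by positivity) hK.le, inv_div, hP, hQ]
  have hνs : ν ^ (2 * s) = ν ^ a * ν ^ (5 * b) := by
    rw [← Real.rpow_add hν]
    congr 1
    rw [ha_def, hb_def]
    ring
  have hE4b : 0 < E ^ (4 * b) := Real.rpow_pos_of_pos hE _
  have halg : E ^ (2 * s - 1) * (c₁ * ν ^ a * D ^ (-b)) = c₁ * (4 * c₂) ^ b * ν ^ (2 * s) := by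
    have e4b : 2 * s - 1 = 4 * b := by rw [hb_def]; ring
    rw [e4b, hDb, hνs]
    field_simp
  -- assemble in `ℝ≥0∞`
  have hreal : c₁ * ν ^ a * D ^ (-b) ≤ c₁ * ν ^ a * (T - t) ^ (-b) :=
    mul_le_mul_of_nonneg_left hpow (by positivity)
  calc ENNReal.ofReal (c₁ * (4 * c₂) ^ b * ν ^ (2 * s))
      = ENNReal.ofReal (E ^ (2 * s - 1) * (c₁ * ν ^ a * D ^ (-b))) := by rw [halg]
    _ = ENNReal.ofReal (E ^ (2 * s - 1)) * ENNReal.ofReal (c₁ * ν ^ a * D ^ (-b)) :=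
        ENNReal.ofReal_mul (Real.rpow_nonneg hE.le _)
    _ ≤ ENNReal.ofReal E ^ (2 * s - 1) * X := by
        rw [ENNReal.ofReal_rpow_of_pos hE]
        exact mul_le_mul' le_rfl ((ENNReal.ofReal_le_ofReal hreal).trans hclock)

/-- **L51-P — THE SCALE-INVARIANT LADDER PRODUCTS, `Ḃ^s_{2,1}` CURRENCY.** For every `s ∈ (1/2, 3/2]` there is
`c = c_s > 0` such that along every maximal smooth solution `(u, p)` of the unforced Navier–Stokes system on
`ℝ³ × [0, T)` (`ν > 0`) which is Leray–Hopf from `u 0`, at EVERY `t ∈ (0, T)`: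
`c · ν^{2s} ≤ ‖u(t)‖₂^{2s−1} · ∑_j 2^{sj} ‖Δ̇_j u(t)‖₂` — the machine is never small in the scale-invariant pairing of
the energy with the `s`-row (L51 × Leray's deadline L23). At `s = 1` compare L23′ (`2cν⁴ ≤ ‖u‖₂² Z`), at `s = 3/2`
`LerayTimeFace.amplitude_energy_product_ge` (`c'ν³ ≤ ‖u‖_∞ ‖u‖₂²`). [cite: Leray1934, §22 p. 227, §34 (6.4) p. 246]
[cite: RobinsonSadowski2014, Corollary 10] -/
theorem ladder_energy_product (s : ℝ) (hs : s ∈ Ioc (1 / 2 : ℝ) (3 / 2)) :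
    ∃ c : ℝ, 0 < c ∧ ∀ (ν T : ℝ), 0 < ν → 0 < T →
      ∀ (u : ℝ → EuclideanSpace ℝ (Fin 3) → EuclideanSpace ℝ (Fin 3)) (p : ℝ → EuclideanSpace ℝ (Fin 3) → ℝ),
      IsMaximalSmoothSolution ν 0 u p T → IsLerayHopfOn T ν 0 (u 0) u →
      ∀ t ∈ Ioo 0 T,
        ENNReal.ofReal (c * ν ^ (2 * s)) ≤
          eLpNorm (u t) 2 volume ^ (2 * s - 1) * ∑' j : ℤ, (2 : ℝ≥0∞) ^ (s * (j : ℝ)) * blockL2 (u t) j := by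
  obtain ⟨c₁, hc₁, H₁⟩ := ladder_clock s hs
  obtain ⟨c₂, hc₂, H₂⟩ := LerayDeadline.deadline
  refine ⟨c₁ * (4 * c₂) ^ ((2 * s - 1) / 4), by positivity, fun ν T hν hT u p hmax hLH t ht => ?_⟩
  have hE : eLpNorm (u t) 2 volume = ENNReal.ofReal (eLpNorm (u t) 2 volume).toReal :=
    (ENNReal.ofReal_toReal (hLH.memLp t ⟨ht.1.le, ht.2.le⟩).eLpNorm_ne_top).symm
  rw [hE]
  exact product_of_clock_and_deadline hc₁ hc₂ hν hs.1 ht.2 ENNReal.toReal_nonneg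
    (H₂ ν T hν hT u p hmax hLH t ⟨ht.1.le, ht.2⟩) (H₁ ν T hν hT u p hmax hLH t ht)

/-- **L52-P — THE SCALE-INVARIANT LADDER PRODUCTS, `Ḣ^s` CURRENCY.** For every `s ∈ (1/2, 3/2)` there is
`c = c_s > 0` such that along every maximal smooth Leray–Hopf solution of the unforced system (`ν > 0`), at EVERY
`t ∈ (0, T)`: `c · ν^{2s} ≤ ‖u(t)‖₂^{2s−1} · ‖u(t)‖_{Ḣ^s}` (L52 × L23; both sides have the dimension of `ν^{2s}`).
As `s ↓ 1/2` the energy exponent vanishes and the statement degenerates to Kato's floor (L28′). [cite: Leray1934, §34 (6.4) p. 246]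
[cite: RobinsonSadowski2014, Corollary 10] -/
theorem homSobolev_energy_product (s : ℝ) (hs : s ∈ Ioo (1 / 2 : ℝ) (3 / 2)) :
    ∃ c : ℝ, 0 < c ∧ ∀ (ν T : ℝ), 0 < ν → 0 < T →
      ∀ (u : ℝ → EuclideanSpace ℝ (Fin 3) → EuclideanSpace ℝ (Fin 3)) (p : ℝ → EuclideanSpace ℝ (Fin 3) → ℝ),
      IsMaximalSmoothSolution ν 0 u p T → IsLerayHopfOn T ν 0 (u 0) u →
      ∀ t ∈ Ioo 0 T,
        ENNReal.ofReal (c * ν ^ (2 * s)) ≤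
          eLpNorm (u t) 2 volume ^ (2 * s - 1) * Function.eHomSobolevSeminorm s (EuclideanSpace.complexify ∘ u t) := by
  obtain ⟨c₁, hc₁, H₁⟩ := homSobolev_clock s hs
  obtain ⟨c₂, hc₂, H₂⟩ := LerayDeadline.deadline
  refine ⟨c₁ * (4 * c₂) ^ ((2 * s - 1) / 4), by positivity, fun ν T hν hT u p hmax hLH t ht => ?_⟩
  have hE : eLpNorm (u t) 2 volume = ENNReal.ofReal (eLpNorm (u t) 2 volume).toReal :=
    (ENNReal.ofReal_toReal (hLH.memLp t ⟨ht.1.le, ht.2.le⟩).eLpNorm_ne_top).symm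
  rw [hE]
  exact product_of_clock_and_deadline hc₁ hc₂ hν hs.1 ht.2 ENNReal.toReal_nonneg
    (H₂ ν T hν hT u p hmax hLH t ⟨ht.1.le, ht.2⟩) (H₁ ν T hν hT u p hmax hLH t ht)

end Summit.NavierStokesRegularity.FluidComputer.SobolevLadderProduct

end
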